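import Summits.Ventures.PercRepro.PuncturedLYMChainInst2_1
import Summits.Ventures.PercRepro.PuncturedLYMChainInst2_2
import Summits.Ventures.PercRepro.PuncturedLYMChainInst2_3
import Summits.Ventures.PercRepro.PuncturedLYMChainInst2_4
import Summits.Ventures.PercRepro.PuncturedLYMChainInst2_5
import Summits.Ventures.PercRepro.PuncturedLYMChainInst2_6
import Summits.Ventures.PercRepro.PuncturedLYMChainInst2_7

/-!
# PercRepro — (SP) BY SUPERPOSITION, PART 14: THEOREM E — (SP) FOR EVERY CODE WITH `j ≤ 15` AND `2j + 1 ≤ n`; (NC) FOR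
EVERY SPARSE PAVING MATROID OF CORANK `≤ 15` (p10, gen 31)

With the two-certificate instances (PuncturedLYMChainInst2_*) on every `(n, j)` with `8 ≤ j ≤ 15`, `2j + 1 ≤ n ≤ 3j − 3`,
Theorem A sharp above `3j − 2` and Theorem D below `j = 8`:
* **`puncturedNMP_of_le_fifteen`** — (SP) for every code with `1 ≤ j ≤ 15` and `2j + 1 ≤ n`;
* `puncturedNMP_in_of_le_fifteen` — the same inside any finset;
* **`normConsAt_of_sparsePaving_corank_le_fifteen`** — (NC) for every sparse paving matroid of corank `n − r ≤ 15` with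
  `r + 1 ≤ n ≤ 2r − 2`, on any ground set.
The pairs `(2j + 1, j)` with `j ≥ 16` are NOT covered: there the two-certificate bound exceeds `1` (by `.009` at `j = 16`).
Nothing here asserts (SP) in general.
-/

open scoped Matroid

namespace PercRepro.PuncturedLYM

open Finset

variable {α : Type} [Fintype α] [DecidableEq α]

/-- **THEOREM E: (SP) holds for every code with `1 ≤ j ≤ 15` and `2j + 1 ≤ n`.** -/
theorem puncturedNMP_of_le_fifteen {j : ℕ} {D : Finset (Finset α)} (hD : IsCode j D) (hj1 : 1 ≤ j) (hj : j ≤ 15)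
    (hn : 2 * j + 1 ≤ Fintype.card α) : PuncturedNMP j D := by
  rcases Nat.lt_or_ge j 8 with hj7 | hj8
  · exact puncturedNMP_of_le_seven hD hj1 (by omega) hn
  rcases Nat.lt_or_ge (Fintype.card α + 2) (3 * j) with hlt | hge
  · obtain ⟨n, hcard⟩ : ∃ n, Fintype.card α = n := ⟨_, rfl⟩
    rw [hcard] at hlt hn
    interval_cases j
    · have hub : n ≤ 21 := by omega
      interval_cases n
      · exact inst2_17_8 hcard hD
      · exact inst_18_8 hcard hD
      · exact inst_19_8 hcard hD
      · exact inst_20_8 hcard hD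
      · exact inst_21_8 hcard hD
    · have hub : n ≤ 24 := by omega
      interval_cases n
      · exact inst2_19_9 hcard hD
      · exact inst_20_9 hcard hD
      · exact inst_21_9 hcard hD
      · exact inst_22_9 hcard hD
      · exact inst_23_9 hcard hD
      · exact inst_24_9 hcard hD
    · have hub : n ≤ 27 := by omega
      interval_cases n
      · exact inst2_21_10 hcard hD
      · exact inst2_22_10 hcard hD
      · exact inst2_23_10 hcard hD
      · exact inst2_24_10 hcard hD
      · exact inst2_25_10 hcard hD
      · exact inst2_26_10 hcard hD
      · exact inst2_27_10 hcard hD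
    · have hub : n ≤ 30 := by omega
      interval_cases n
      · exact inst2_23_11 hcard hD
      · exact inst2_24_11 hcard hD
      · exact inst2_25_11 hcard hD
      · exact inst2_26_11 hcard hD
      · exact inst2_27_11 hcard hD
      · exact inst2_28_11 hcard hD
      · exact inst2_29_11 hcard hD
      · exact inst2_30_11 hcard hD
    · have hub : n ≤ 33 := by omega
      interval_cases n
      · exact inst2_25_12 hcard hD
      · exact inst2_26_12 hcard hD
      · exact inst2_27_12 hcard hD
      · exact inst2_28_12 hcard hD
      · exact inst2_29_12 hcard hD
      · exact inst2_30_12 hcard hD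
      · exact inst2_31_12 hcard hD
      · exact inst2_32_12 hcard hD
      · exact inst2_33_12 hcard hD
    · have hub : n ≤ 36 := by omega
      interval_cases n
      · exact inst2_27_13 hcard hD
      · exact inst2_28_13 hcard hD
      · exact inst2_29_13 hcard hD
      · exact inst2_30_13 hcard hD
      · exact inst2_31_13 hcard hD
      · exact inst2_32_13 hcard hD
      · exact inst2_33_13 hcard hD
      · exact inst2_34_13 hcard hD
      · exact inst2_35_13 hcard hD
      · exact inst2_36_13 hcard hD
    · have hub : n ≤ 39 := by omega
      interval_cases n
      · exact inst2_29_14 hcard hD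
      · exact inst2_30_14 hcard hD
      · exact inst2_31_14 hcard hD
      · exact inst2_32_14 hcard hD
      · exact inst2_33_14 hcard hD
      · exact inst2_34_14 hcard hD
      · exact inst2_35_14 hcard hD
      · exact inst2_36_14 hcard hD
      · exact inst2_37_14 hcard hD
      · exact inst2_38_14 hcard hD
      · exact inst2_39_14 hcard hD
    · have hub : n ≤ 42 := by omega
      interval_cases n
      · exact inst2_31_15 hcard hD
      · exact inst2_32_15 hcard hD
      · exact inst2_33_15 hcard hD
      · exact inst2_34_15 hcard hD
      · exact inst2_35_15 hcard hD
      · exact inst2_36_15 hcard hD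
      · exact inst2_37_15 hcard hD
      · exact inst2_38_15 hcard hD
      · exact inst2_39_15 hcard hD
      · exact inst2_40_15 hcard hD
      · exact inst2_41_15 hcard hD
      · exact inst2_42_15 hcard hD
  · exact puncturedNMP_of_three_j' hD (by omega) hn hge

omit [Fintype α] in
/-- (SP) inside any finset `E` for `1 ≤ j ≤ 15`, `2j + 1 ≤ #E`. -/
theorem puncturedNMP_in_of_le_fifteen {E : Finset α} {j : ℕ} {D : Finset (Finset α)} (hD : IsCodeIn j E D)
    (hj1 : 1 ≤ j) (hj : j ≤ 15) (hn : 2 * j + 1 ≤ E.card) : PuncturedNMPIn j E D := by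
  apply puncturedNMP_in_of_subtype hD
  apply puncturedNMP_of_le_fifteen (isCode_image_toSub hD) hj1 hj
  rw [Fintype.card_coe]
  exact hn

end PercRepro.PuncturedLYM

namespace PercRepro.Cogirth

open Finset ThmH Skew

variable {α : Type} [DecidableEq α] {M : Matroid α} [M.Finite]

/-- **(NC) for every sparse paving matroid of corank `n − r ≤ 15`** with `r + 1 ≤ n` and `n + 2 ≤ 2r`. -/
theorem normConsAt_of_sparsePaving_corank_le_fifteen {r : ℕ} (hsp : IsSparsePavingF M r) (hr1 : r + 1 ≤ (gr M).card)
    (hn : (gr M).card + 2 ≤ 2 * r) (h15 : (gr M).card - r ≤ 15) : NormConsAt M := by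
  intro U hU j
  have hr : r ≤ (gr M).card := by omega
  rcases Nat.lt_or_ge j ((gr M).card - r) with hlt | hge
  · apply normConsStep_of_lt
    rw [hsp.1]
    omega
  rcases Nat.eq_or_lt_of_le hge with heq | hgt
  · rw [← heq]
    apply normConsStep_bottom_of_puncturedNMPIn hsp hn hU
    exact PuncturedLYM.puncturedNMP_in_of_le_fifteen (isCodeIn_cocode hsp hr) (by omega) h15 (by omega)
  rcases Nat.lt_or_ge (j + 1) r with hmid | htop
  · apply normConsStep_of_indep_succ_of_indep_sdiff hU (by omega)
    · intro S hS hSc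
      exact rk_eq_card_of_card_lt_of_sparsePaving hsp hr hS (by omega)
    · intro S hS hSc
      exact rk_eq_card_of_card_lt_of_sparsePaving hsp hr hS (by omega)
  · apply normConsStep_of_rk_le hU
    rw [hsp.1]
    omega

end PercRepro.Cogirth
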